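import Summits.Ventures.YMGap.RobustBall.BoundaryDecayBall
import Summits.Ventures.YMGap.RobustBall.AdjointWitness
import Summits.Ventures.YMGap.RobustBall.PeriodisedBox
import HarnessLib

/-!
# Venture YMGap, track ROBUST-BALL — ONE STATE AT A RATE, a named member: the `SU(2)` MIXED FUNDAMENTAL–ADJOINT ACTION forgets its
# boundary condition exponentially fast

HONEST FRAMING. WHAT THIS IS: a venture file (cell `pub-ymgap`, track Y2 ROBUST-BALL, seat ds-3, theorems only): the boundary-rate
theorem of `BoundaryDecayBall.lean` in rb-p1's lineage (B) — sharp `SU(2)` Poincaré constant `2/3` with the sharp LINEAR VARIANCE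
`v = 2` (`su2_linVariance_sharp`, valid for `|β_W| ≤ 1/6`), row `3√3 |β_W| e^{ε₀} + e^{ε₀/2} √(2/3) ε₁` — and its reading for the named
member of `AdjointWitness.lean`, the mixed fundamental–adjoint action `(β_W/2) S_W + t Σ_p (Re tr U_p)²`-type member `adjointWitness t`
(`MemBallZd (6|t|) (48|t|/√2) 1`, `memBallZd_adjointWitness`):
* `su2_abs_boundary_sub_integral_le_sharpB` — `SU(2)`, `d = 4`, `|β_W| ≤ 1/6`, lineage (B): on `MemBallZd ε₀ ε₁ R`,
  `3√3 |β_W| e^{ε₀} + e^{ε₀/2} √(2/3) ε₁ ≤ ρ < 1` ⇒ `|∫ F dγ^W_Λ(· | η) − ∫ F dμ| ≤ 2√2 · K · #Δ · max(ρ,½)^{⌊D/max(1,R)⌋}`;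
* ★ `su2_mixedAction_boundary_1_8` — `β_W = 1/8`, `|t| ≤ 1/100` (the cell of `su2_mixedAction_massGap_1_8`): for every DLR state (there is
  exactly one), every volume, EVERY boundary field and every Lipschitz cylinder at depth `≥ D`:
  `|∫ F dγ_Λ(· | η) − ∫ F dμ| ≤ 2√2 · K · #Δ · (49/50)^{⌊D⌋}` (certified row value `< 0.9753 ≤ 49/50`);
  `su2_mixedAction_box_1_8` (boxes: `(49/50)^{n−m}`).
WHAT THIS IS NOT: the ratio `49/50` is the Dobrushin row sum of this member at this coupling, a (weak) lower bound on the true rate;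
lattice strong coupling; nothing about the continuum limit or the Clay Millennium problem.

References: H. Föllmer, LNM 1362 (1988), Ch. I, (2.8)/(2.10); rb-p1's `RowsSU2.lean` (`su2_massGapOnBallZd_sharp`), `AdjointWitness.lean`;
the seat's `BoundaryDecayBall.lean`.
-/

noncomputable section

open MeasureTheory Filter Function ProbabilityTheory Real
open scoped NNReal
open Literature.Probability.LatticeModels
open Literature.Probability.LatticeModels.DobrushinMetric
open Literature.MathematicalPhysics.QuantumLattice
open Literature.MathematicalPhysics.QuantumFieldTheory hiding ZdEdge
open Summit.QuantumFields.BalabanUV.InfraRed.StrongCouplingPoincareDoorSUN (oneLinkPoincareSUN_two_sharp)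

namespace Summit.Ventures.YMGap.RobustBall

/-- **`SU(2)`, `d = 4`, LINEAGE (B)** (sharp Poincaré constant `2/3`, sharp linear variance `2` for `|β_W| ≤ 1/6`; `√(c v) = 2/√3`): if
`3√3 |β_W| e^{ε₀} + e^{ε₀/2} √(2/3) ε₁ ≤ ρ < 1` then on the whole ball `MemBallZd ε₀ ε₁ R` every finite-volume Gibbs distribution with ANY
boundary field approximates every DLR state on Lipschitz cylinders at depth `D` to accuracy `2√2 · K · #Δ · max(ρ,½)^{⌊D/max(1,R)⌋₊}`.
[folklore] -/
theorem su2_abs_boundary_sub_integral_le_sharpB {βW ε₀ ε₁ ρ R : ℝ} (hβ : |βW| ≤ 1 / 6)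
    (hρ : 3 * Real.sqrt 3 * |βW| * exp ε₀ + exp (ε₀ / 2) * Real.sqrt (2 / 3) * ε₁ ≤ ρ) (hρ1 : ρ < 1)
    {W : Potential (ZdEdge 4) (Matrix.specialUnitaryGroup (Fin 2) ℂ)}
    {supp : Finset (ZdEdge 4) → Finset (Finset (ZdEdge 4))} (hmem : MemBallZd ε₀ ε₁ R W supp)
    {μ : Measure (LGConfig 4 (Matrix.specialUnitaryGroup (Fin 2) ℂ))}
    (hμ : μ ∈ perturbedGibbsMeasures (d := 4) (fundamentalRep (Fin 2)) ((2 : ℕ) * (βW / 4)) W supp)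
    (Λ : Finset (ZdEdge 4)) (η : LGConfig 4 (Matrix.specialUnitaryGroup (Fin 2) ℂ))
    {F : LGConfig 4 (Matrix.specialUnitaryGroup (Fin 2) ℂ) → ℝ} {Δ : Finset (ZdEdge 4)} {K : ℝ≥0}
    (hF : IsLipschitzCylinder (fundamentalRep (Fin 2)) F Δ K) {D : ℝ}
    (hD : ∀ y ∈ Δ, ∀ z, z ∉ Λ → D ≤ ‖y.1 - z.1‖) :
    |(∫ U, F U ∂(perturbedYM (d := 4) (fundamentalRep (Fin 2)) ((2 : ℕ) * (βW / 4)) W supp Λ η)) - ∫ U, F U ∂μ| ≤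
      2 * Real.sqrt 2 * K * Δ.card * (max ρ (1 / 2)) ^ ⌊D / max 1 R⌋₊ := by
  have hc : (0 : ℝ) ≤ 2 / 3 := by norm_num
  have hb : |βW / 4| * (2 * (((4 : ℕ) : ℝ) - 1)) ≤ 1 / 4 := by
    rw [abs_div, abs_of_pos (by norm_num : (0 : ℝ) < 4)]
    norm_num
    linarith
  have hP : ∀ B : Matrix (Fin 2) (Fin 2) ℂ, matrixOpNorm B ≤ 1 / 4 →
      ∀ (ψ : Matrix.specialUnitaryGroup (Fin 2) ℂ → ℝ) (M : ℝ), 0 ≤ M →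
        (∀ x y, |ψ x - ψ y| ≤ M * suFrobDist x y) →
        Var[ψ; (haarProbability (Matrix.specialUnitaryGroup (Fin 2) ℂ)).tilted
          fun g => ((2 : ℕ) : ℝ) * ((g : Matrix (Fin 2) (Fin 2) ℂ) * B).trace.re] ≤ 2 / 3 * M ^ 2 :=
    fun B hB ψ M hM hψ => oneLinkPoincareSUN_two_sharp _ B hB ψ M hM hψ
  have hsq : Real.sqrt (2 / 3 * 2) = 2 * Real.sqrt 3 / 3 := by
    have h3 : (2 * Real.sqrt 3 / 3) ^ 2 = 2 / 3 * 2 := by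
      rw [div_pow, mul_pow, Real.sq_sqrt (by norm_num)]; norm_num
    rw [← h3, Real.sqrt_sq (by positivity)]
  have hρ' : 6 * (((4 : ℕ) : ℝ) - 1) * |βW / 4| * (exp ε₀ * Real.sqrt (2 / 3 * 2)) + exp (ε₀ / 2) * Real.sqrt (2 / 3) * ε₁ ≤ ρ := by
    rw [hsq]
    have e : 6 * (((4 : ℕ) : ℝ) - 1) * |βW / 4| * (exp ε₀ * (2 * Real.sqrt 3 / 3)) = 3 * Real.sqrt 3 * |βW| * exp ε₀ := by
      rw [abs_div, abs_of_pos (by norm_num : (0 : ℝ) < 4)]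
      ring
    rw [e]
    exact hρ
  have h := abs_boundary_sub_integral_le_of_pair (d := 4) (N := 2) (by norm_num) (by norm_num) (R := R) hc zero_le_two hb hP
    (su2_linVariance_sharp le_rfl) hρ' hρ1 hmem hμ Λ η hF hD
  have e2 : Real.sqrt ((2 : ℕ) : ℝ) = Real.sqrt 2 := by norm_num
  rw [e2] at h
  exact h

/-- ★ **THE MIXED FUNDAMENTAL–ADJOINT `SU(2)` ACTION ON `ℤ⁴` AT `β_W = 1/8`, `|t| ≤ 1/100`** (the cell of `su2_mixedAction_massGap_1_8`;
member `adjointWitness t ∈ MemBallZd (6|t|) (48|t|/√2) 1`): for every DLR state `μ` of the member (there is exactly one), every finite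
volume `Λ`, EVERY boundary field `η`, and every Lipschitz cylinder `F` (constant `K`, links `Δ` at depth `≥ D` in `Λ`):
`|∫ F dγ_Λ(· | η) − ∫ F dμ| ≤ 2√2 · K · #Δ · (49/50)^{⌊D⌋}`. [folklore] -/
theorem su2_mixedAction_boundary_1_8 {t : ℝ} (ht : |t| ≤ 1 / 100)
    {μ : Measure (LGConfig 4 (Matrix.specialUnitaryGroup (Fin 2) ℂ))}
    (hμ : μ ∈ perturbedGibbsMeasures (d := 4) (fundamentalRep (Fin 2)) ((2 : ℕ) * ((1 / 8 : ℝ) / 4)) (adjointWitness t) plaquetteSupp)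
    (Λ : Finset (ZdEdge 4)) (η : LGConfig 4 (Matrix.specialUnitaryGroup (Fin 2) ℂ))
    {F : LGConfig 4 (Matrix.specialUnitaryGroup (Fin 2) ℂ) → ℝ} {Δ : Finset (ZdEdge 4)} {K : ℝ≥0}
    (hF : IsLipschitzCylinder (fundamentalRep (Fin 2)) F Δ K) {D : ℝ}
    (hD : ∀ y ∈ Δ, ∀ z, z ∉ Λ → D ≤ ‖y.1 - z.1‖) :
    |(∫ U, F U ∂(perturbedYM (d := 4) (fundamentalRep (Fin 2)) ((2 : ℕ) * ((1 / 8 : ℝ) / 4)) (adjointWitness t) plaquetteSupp Λ η)) -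
        ∫ U, F U ∂μ| ≤ 2 * Real.sqrt 2 * K * Δ.card * (49 / 50 : ℝ) ^ ⌊D⌋₊ := by
  have hmem := memBallZd_adjointWitness (d := 4) (N := 2) (by norm_num) (by norm_num) t
  have h3 : (2 : ℝ) * (((4 : ℕ) : ℝ) - 1) = 6 := by norm_num
  have h16 : (16 : ℝ) * (((4 : ℕ) : ℝ) - 1) = 48 := by norm_num
  rw [h3, h16] at hmem
  have hρ : 3 * Real.sqrt 3 * |(1 / 8 : ℝ)| * exp (6 * |t|) + exp (6 * |t| / 2) * Real.sqrt (2 / 3) * (48 * |t| / Real.sqrt ((2 : ℕ) : ℝ))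
      ≤ 49 / 50 := by
    have ht0 : 0 ≤ |t| := abs_nonneg t
    have h1 := exp_le_taylor4 (x := 6 * |t|) (by positivity) (by linarith)
    have h2 := exp_le_taylor4 (x := 3 * |t|) (by positivity) (by linarith)
    have hs2 : Real.sqrt ((2 : ℕ) : ℝ) = Real.sqrt 2 := by norm_num
    rw [hs2, show 6 * |t| / 2 = 3 * |t| by ring, abs_of_pos (by norm_num : (0 : ℝ) < 1 / 8)]
    have hinv : 48 * |t| / Real.sqrt 2 ≤ 48 * |t| / (141421 / 100000) :=
      div_le_div_of_nonneg_left (by positivity) (by norm_num) sqrt_two_ge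
    calc 3 * Real.sqrt 3 * (1 / 8) * exp (6 * |t|) + exp (3 * |t|) * Real.sqrt (2 / 3) * (48 * |t| / Real.sqrt 2)
        ≤ 3 * (1732051 / 1000000) * (1 / 8) *
            (1 + 6 * |t| + (6 * |t|) ^ 2 / 2 + (6 * |t|) ^ 3 / 6 + 5 / 96 * (6 * |t|) ^ 4) +
          (1 + 3 * |t| + (3 * |t|) ^ 2 / 2 + (3 * |t|) ^ 3 / 6 + 5 / 96 * (3 * |t|) ^ 4) *
            (8165 / 10000) * (48 * |t| / (141421 / 100000)) := by
          gcongr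
          · exact sqrt_three_le_bound
          · exact sqrt_two_thirds_le
      _ ≤ 3 * (1732051 / 1000000) * (1 / 8) *
            (1 + 6 * (1 / 100 : ℝ) + (6 * (1 / 100 : ℝ)) ^ 2 / 2 + (6 * (1 / 100 : ℝ)) ^ 3 / 6 +
              5 / 96 * (6 * (1 / 100 : ℝ)) ^ 4) +
          (1 + 3 * (1 / 100 : ℝ) + (3 * (1 / 100 : ℝ)) ^ 2 / 2 + (3 * (1 / 100 : ℝ)) ^ 3 / 6 +
              5 / 96 * (3 * (1 / 100 : ℝ)) ^ 4) *
            (8165 / 10000) * (48 * (1 / 100 : ℝ) / (141421 / 100000)) := by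
          gcongr
      _ ≤ 49 / 50 := by norm_num
  have h := su2_abs_boundary_sub_integral_le_sharpB (βW := 1 / 8) (by rw [abs_of_pos (by norm_num : (0 : ℝ) < 1 / 8)]; norm_num)
    hρ (by norm_num) hmem hμ Λ η hF hD
  rwa [show max (49 / 50 : ℝ) (1 / 2) = 49 / 50 by norm_num, max_self, div_one] at h

/-- **Boxes**: for the mixed action at `β_W = 1/8`, `|t| ≤ 1/100`, every DLR state `μ`, every pair of box sizes `m, n`, EVERY boundary field on
`boxLinks 4 n` and every Lipschitz cylinder on `boxLinks 4 m`: `|∫ F dγ_{box n}(· | η) − ∫ F dμ| ≤ 2√2 · K · #Δ · (49/50)^{n − m}`. [folklore] -/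
theorem su2_mixedAction_box_1_8 {t : ℝ} (ht : |t| ≤ 1 / 100)
    {μ : Measure (LGConfig 4 (Matrix.specialUnitaryGroup (Fin 2) ℂ))}
    (hμ : μ ∈ perturbedGibbsMeasures (d := 4) (fundamentalRep (Fin 2)) ((2 : ℕ) * ((1 / 8 : ℝ) / 4)) (adjointWitness t) plaquetteSupp)
    {m : ℕ} (n : ℕ) (η : LGConfig 4 (Matrix.specialUnitaryGroup (Fin 2) ℂ))
    {F : LGConfig 4 (Matrix.specialUnitaryGroup (Fin 2) ℂ) → ℝ} {Δ : Finset (ZdEdge 4)} {K : ℝ≥0}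
    (hF : IsLipschitzCylinder (fundamentalRep (Fin 2)) F Δ K) (hΔ : Δ ⊆ boxLinks 4 m) :
    |(∫ U, F U ∂(perturbedYM (d := 4) (fundamentalRep (Fin 2)) ((2 : ℕ) * ((1 / 8 : ℝ) / 4)) (adjointWitness t) plaquetteSupp
        (boxLinks 4 n) η)) - ∫ U, F U ∂μ| ≤ 2 * Real.sqrt 2 * K * Δ.card * (49 / 50 : ℝ) ^ (n - m) := by
  have key := su2_mixedAction_boundary_1_8 ht hμ (boxLinks 4 n) η hF (D := (n : ℝ) - m) fun y hy z hz => by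
    have hy' := hΔ hy
    rw [mem_boxLinks, mem_siteBox_iff_norm] at hy' hz
    have hz' : (n : ℝ) < ‖z.1‖ := lt_of_not_ge hz
    have h := norm_sub_norm_le z.1 y.1
    rw [norm_sub_rev] at h
    linarith
  have hfloor : ⌊(n : ℝ) - m⌋₊ = n - m := by
    rcases le_or_gt m n with h | h
    · rw [← Nat.cast_sub h, Nat.floor_natCast]
    · rw [Nat.floor_of_nonpos (by linarith [(Nat.cast_lt (α := ℝ)).2 h]), eq_comm]
      omega
  rwa [hfloor] at key

end Summit.Ventures.YMGap.RobustBall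

end
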